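import Summits.QuantumFields.QCD.Theses.NestedDissectionSea
import Summits.QuantumFields.QCD.Theorems.EarlyCrosserLaw.Negative.LowerPinLoadBearing
import Literature.MathematicalPhysics.QuantumFieldTheory.QCDGoldstoneBound
import Summits.QuantumFields.QCD.Theorems.PauliWegnerSeaChiralGluonicCompletionRestrict

/-!
# Crux `LightQuarkCompletion` (stmt-QuantumFields-18066, route NestedDissectionSea) — line `Sketch`: the glue, landed

The sorry-free part of the registered skeleton `Cruxes/LightQuarkCompletion/Lines/Sketch.lean` (namespace
`Summit.QuantumFields.QCD.Theorems.LightQuarkJumpLine`, lead prover-line-stmt-QuantumFields-18066-0, 2026-08-17):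

* §1 heredity along subsequences (`QCDRegularisation.restrict`; both scalings are the landed
  `StronglyChiralSubsequence.hasMassScaling_restrict` / `hasAsymptoticScaling_restrict`): the weak branch
  `-1 ≤ m_crit(k)`, the lower pin (b) (`CoerciveSeaNegative.PinClause`), the upper pin (b″)
  (`EarlyCrosserLawNegative.UpperPin`), `IsQCDAlong` (species renormalisations reindexed; lattice Schwinger functions
  reindex definitionally), the uniform lattice gap, and the whole `QCDOf` body above a threshold;
* §2 re-centring `m_crit ↦ m_crit + a J / Z_m` (the explicit `QCDRegularisation.mk`, all other data kept): both
  scalings are untouched and `m_crit → 0` survives (`a_k J / Z_m(k) → 0` from `HasMassScaling`, `N_f ≤ 16`);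
* §3 `lightQuarkCompletion_of_stubs`: the composition of the line — the crux `NestedDissectionSea.LightQuarkCompletion`
  BY NAME from its four registered stubs TAKEN AS HYPOTHESES (B2a jump germ, B2b physical branch, B2c light body,
  J jump line is chiral; statements verbatim the registered signatures). Conditional: it credits nothing until the
  stubs land, and records kernel-checked that the four stubs are jointly sufficient.

Pure logic over the tree's definitions; no definition introduced; nothing here asserts a Theses decl unconditionally.
-/

noncomputable section

namespace Summit.QuantumFields.QCD.Theorems.LightQuarkJumpLine

open MeasureTheory Filter Topology
open Literature.MathematicalPhysics.QuantumFieldTheory Literature.MathematicalPhysics.QuantumLattice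
  Literature.Probability.LatticeModels
open Summit.QuantumFields.QCD.Theorems.CoerciveSeaNegative (PinClause tendsto_a_div_Zm massExponent_pos)
open Summit.QuantumFields.QCD.Theorems.EarlyCrosserLawNegative (UpperPin)

/-! ## §1 Heredity along subsequences -/

section Heredity

variable {Nf : ℕ} (reg : QCDRegularisation Nf) (φ : ℕ → ℕ) (hφ : StrictMono φ)

/-- The weak branch clause passes to every subsequence. -/
theorem branch_restrict (h : ∀ᶠ k : ℕ in atTop, -1 ≤ reg.mcrit k) :
    ∀ᶠ k : ℕ in atTop, -1 ≤ (reg.restrict φ hφ.tendsto_atTop).mcrit k :=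
  hφ.tendsto_atTop.eventually h

/-- The lower pin (b) passes to every subsequence (an `∀ᶠ k` clause with `k`-uniform data). -/
theorem pinClause_restrict {M₀ : ℝ} {m : Fin Nf → ℝ} {R : ℝ} (h : PinClause Nf reg M₀ m R) :
    PinClause Nf (reg.restrict φ hφ.tendsto_atTop) M₀ m R := by
  intro M hM
  exact hφ.tendsto_atTop.eventually (h M hM)

/-- The upper pin (b″) passes to every subsequence. -/
theorem upperPin_restrict {M₀ : ℝ} {m : Fin Nf → ℝ} {R : ℝ} (h : UpperPin Nf reg M₀ m R) :
    UpperPin Nf (reg.restrict φ hφ.tendsto_atTop) M₀ m R := by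
  intro M hM
  exact hφ.tendsto_atTop.eventually (h M hM)

/-- The two-sided pin above `M₀` passes to every subsequence. -/
theorem pin_restrict {M₀ : ℝ}
    (h : ∀ m : Fin Nf → ℝ, (∀ f, M₀ < m f) → ∃ R : ℝ, 0 < R ∧ PinClause Nf reg M₀ m R ∧ UpperPin Nf reg M₀ m R) :
    ∀ m : Fin Nf → ℝ, (∀ f, M₀ < m f) → ∃ R : ℝ, 0 < R ∧
      PinClause Nf (reg.restrict φ hφ.tendsto_atTop) M₀ m R ∧ UpperPin Nf (reg.restrict φ hφ.tendsto_atTop) M₀ m R := by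
  intro m hm
  obtain ⟨R, hR, hb, hb2⟩ := h m hm
  exact ⟨R, hR, pinClause_restrict reg φ hφ hb, upperPin_restrict reg φ hφ hb2⟩

/-- `IsQCDAlong` passes to every subsequence (with the species renormalisations reindexed; the lattice Schwinger
functions of the reindexed scheme at step `k` are those of the original scheme at step `φ k`, definitionally). -/
theorem isQCDAlong_restrict (m : Fin Nf → ℝ) (z shift : QCDField Nf → ℕ → ℝ) (T : OSData (QCDField Nf) 4)
    (h : IsQCDAlong (reg.scheme m z shift) T) :
    IsQCDAlong ((reg.restrict φ hφ.tendsto_atTop).scheme m (fun s => z s ∘ φ) (fun s => shift s ∘ φ)) T := by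
  obtain ⟨hAS, hbr, hconv⟩ := h
  refine ⟨?_, fun fl => hφ.tendsto_atTop.eventually (hbr fl), fun n hn σ f F hF hoff => ?_⟩
  · obtain ⟨Λ, hΛ, ht⟩ := hAS
    exact ⟨Λ, hΛ, ht.comp hφ.tendsto_atTop⟩
  · exact (hconv n hn σ f F hF hoff).comp hφ.tendsto_atTop

/-- The uniform lattice gap passes to every subsequence. -/
theorem hasLatticeMassGap_restrict (m : Fin Nf → ℝ) (z shift : QCDField Nf → ℕ → ℝ) {Δ : ℝ}
    (h : (reg.scheme m z shift).HasLatticeMassGap Δ) :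
    ((reg.restrict φ hφ.tendsto_atTop).scheme m (fun s => z s ∘ φ) (fun s => shift s ∘ φ)).HasLatticeMassGap Δ := by
  intro R R' A B
  obtain ⟨C, hC⟩ := h R R' A B
  exact ⟨C, hφ.tendsto_atTop.eventually hC⟩

end Heredity

/-- The `QCDOf` body above a threshold passes to every subsequence (registered helper of line `Sketch`). -/
theorem body_restrict : ∀ {Nf : ℕ} (reg : QCDRegularisation Nf) (φ : ℕ → ℕ) (hφ : StrictMono φ) {M₀ : ℝ},
    (∀ m : Fin Nf → ℝ, (∀ f, M₀ < m f) → ∃ (z shift : QCDField Nf → ℕ → ℝ) (T : OSData (QCDField Nf) 4),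
      IsQCDAlong (reg.scheme m z shift) T ∧ T.IsNontrivial QCDField.glue ∧ T.IsNonGaussian QCDField.glue ∧
        (∀ f g : Fin Nf, f ≠ g → T.IsNontrivial (QCDField.pseudoRe f g)) ∧
          ∃ Δ > 0, T.HasMassGap Δ ∧ (reg.scheme m z shift).HasLatticeMassGap Δ) →
    ∀ m : Fin Nf → ℝ, (∀ f, M₀ < m f) → ∃ (z shift : QCDField Nf → ℕ → ℝ) (T : OSData (QCDField Nf) 4),
      IsQCDAlong ((reg.restrict φ hφ.tendsto_atTop).scheme m z shift) T ∧ T.IsNontrivial QCDField.glue ∧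
        T.IsNonGaussian QCDField.glue ∧ (∀ f g : Fin Nf, f ≠ g → T.IsNontrivial (QCDField.pseudoRe f g)) ∧
          ∃ Δ > 0, T.HasMassGap Δ ∧ ((reg.restrict φ hφ.tendsto_atTop).scheme m z shift).HasLatticeMassGap Δ := by
  intro Nf reg φ hφ M₀ h m hm
  obtain ⟨z, shift, T, hQ, hN, hG, hP, Δ, hΔ, hT, hL⟩ := h m hm
  exact ⟨fun s => z s ∘ φ, fun s => shift s ∘ φ, T, isQCDAlong_restrict reg φ hφ m z shift T hQ, hN, hG, hP, Δ, hΔ,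
    hT, hasLatticeMassGap_restrict reg φ hφ m z shift hL⟩


/-! ## §2 Re-centring at a germ -/

section Recentre

variable {Nf : ℕ} (reg : QCDRegularisation Nf) (J : ℝ)

/-- Re-centring `m_crit ↦ m_crit + a J / Z_m` keeps `HasMassScaling` (which reads only `a, Z_m`). -/
theorem hasMassScaling_recentre (h : reg.HasMassScaling) :
    (QCDRegularisation.mk reg.a reg.a_pos reg.tendsto_a reg.β reg.L reg.tendsto_L
        (fun k => reg.mcrit k + reg.a k * J / reg.Zm k) reg.Zm reg.Zm_pos : QCDRegularisation Nf).HasMassScaling :=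
  h

/-- Re-centring keeps two-loop asymptotic scaling (which reads only `a, β`). -/
theorem hasAsymptoticScaling_recentre (h : (reg.scheme 0 0 0).HasAsymptoticScaling) :
    ((QCDRegularisation.mk reg.a reg.a_pos reg.tendsto_a reg.β reg.L reg.tendsto_L
        (fun k => reg.mcrit k + reg.a k * J / reg.Zm k) reg.Zm reg.Zm_pos : QCDRegularisation Nf).scheme
      0 0 0).HasAsymptoticScaling :=
  h

/-- `m_crit → 0` survives re-centring: `a_k J / Z_m(k) → 0` by `HasMassScaling` (`N_f ≤ 16`). -/
theorem tendsto_mcrit_recentre (hNf : Nf ≤ 16) (hMS : reg.HasMassScaling) (h : Tendsto reg.mcrit atTop (𝓝 0)) :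
    Tendsto (QCDRegularisation.mk reg.a reg.a_pos reg.tendsto_a reg.β reg.L reg.tendsto_L
        (fun k => reg.mcrit k + reg.a k * J / reg.Zm k) reg.Zm reg.Zm_pos : QCDRegularisation Nf).mcrit
      atTop (𝓝 0) := by
  have haz : Tendsto (fun k => reg.a k / reg.Zm k * J) atTop (𝓝 0) := by
    simpa using (tendsto_a_div_Zm reg hMS (massExponent_pos hNf)).mul_const J
  have hsum := h.add haz
  rw [add_zero] at hsum
  refine hsum.congr fun k => ?_
  show reg.mcrit k + reg.a k / reg.Zm k * J = reg.mcrit k + reg.a k * J / reg.Zm k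
  ring

end Recentre

/-! ## §3 The composition of the line -/

/-- **The four registered stubs of line `Sketch` are jointly sufficient for the crux** (pure bookkeeping; the
hypotheses are VERBATIM the registered signatures of `stub_jumpGerm`, `stub_physicalBranch`, `stub_lightBody`,
`stub_jumpLineIsChiral`).  Given `N_f ∈ {2,3}` and a threshold regularisation `reg` with its package: (B2a) pick the
subsequence `φ` and the germ `J`; the package passes to `reg₁ := reg.restrict φ` (§1); (B2b) on `reg₁` gives
`m_crit ∘ φ → 0`, hence `m_crit' → 0` for `reg₁` re-centred at `J` (§2); (B2c) gives the body of the re-centred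
regularisation at every positive tuple; both scalings ride along; (J) applied to it gives `IsChiralAtZero` — the six
conjuncts of the conclusion, with the re-centred `reg₁` as the witness. -/
theorem lightQuarkCompletion_of_stubs
    (hGerm : ∀ Nf : ℕ, (Nf = 2 ∨ Nf = 3) → ∀ reg : QCDRegularisation Nf, reg.HasMassScaling →
      (reg.scheme 0 0 0).HasAsymptoticScaling → (∀ᶠ k : ℕ in atTop, -1 ≤ reg.mcrit k) → ∀ M₀ : ℝ, 0 ≤ M₀ →
      (∀ m : Fin Nf → ℝ, (∀ f, M₀ < m f) → ∃ R : ℝ, 0 < R ∧ PinClause Nf reg M₀ m R ∧ UpperPin Nf reg M₀ m R) →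
      (∀ m : Fin Nf → ℝ, (∀ f, M₀ < m f) → ∃ (z shift : QCDField Nf → ℕ → ℝ) (T : OSData (QCDField Nf) 4),
      IsQCDAlong (reg.scheme m z shift) T ∧ T.IsNontrivial QCDField.glue ∧ T.IsNonGaussian QCDField.glue ∧
      (∀ f g : Fin Nf, f ≠ g → T.IsNontrivial (QCDField.pseudoRe f g)) ∧
      ∃ Δ > 0, T.HasMassGap Δ ∧ (reg.scheme m z shift).HasLatticeMassGap Δ) →
      ∃ (φ : ℕ → ℕ) (hφ : StrictMono φ) (J : ℝ), ∀ m : Fin Nf → ℝ, (∀ f, 0 < m f) → ∃ R : ℝ, 0 < R ∧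
      PinClause Nf (QCDRegularisation.mk (reg.restrict φ hφ.tendsto_atTop).a (reg.restrict φ hφ.tendsto_atTop).a_pos
      (reg.restrict φ hφ.tendsto_atTop).tendsto_a (reg.restrict φ hφ.tendsto_atTop).β (reg.restrict φ hφ.tendsto_atTop).L
      (reg.restrict φ hφ.tendsto_atTop).tendsto_L (fun k => (reg.restrict φ hφ.tendsto_atTop).mcrit k +
      (reg.restrict φ hφ.tendsto_atTop).a k * J / (reg.restrict φ hφ.tendsto_atTop).Zm k)
      (reg.restrict φ hφ.tendsto_atTop).Zm (reg.restrict φ hφ.tendsto_atTop).Zm_pos) 0 m R ∧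
      UpperPin Nf (QCDRegularisation.mk (reg.restrict φ hφ.tendsto_atTop).a (reg.restrict φ hφ.tendsto_atTop).a_pos
      (reg.restrict φ hφ.tendsto_atTop).tendsto_a (reg.restrict φ hφ.tendsto_atTop).β (reg.restrict φ hφ.tendsto_atTop).L
      (reg.restrict φ hφ.tendsto_atTop).tendsto_L (fun k => (reg.restrict φ hφ.tendsto_atTop).mcrit k +
      (reg.restrict φ hφ.tendsto_atTop).a k * J / (reg.restrict φ hφ.tendsto_atTop).Zm k)
      (reg.restrict φ hφ.tendsto_atTop).Zm (reg.restrict φ hφ.tendsto_atTop).Zm_pos) 0 m R)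
    (hBranch : ∀ Nf : ℕ, (Nf = 2 ∨ Nf = 3) → ∀ reg : QCDRegularisation Nf, reg.HasMassScaling →
      (reg.scheme 0 0 0).HasAsymptoticScaling → (∀ᶠ k : ℕ in atTop, -1 ≤ reg.mcrit k) → ∀ M₀ : ℝ, 0 ≤ M₀ →
      (∀ m : Fin Nf → ℝ, (∀ f, M₀ < m f) → ∃ R : ℝ, 0 < R ∧ PinClause Nf reg M₀ m R ∧ UpperPin Nf reg M₀ m R) →
      (∀ m : Fin Nf → ℝ, (∀ f, M₀ < m f) → ∃ (z shift : QCDField Nf → ℕ → ℝ) (T : OSData (QCDField Nf) 4),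
      IsQCDAlong (reg.scheme m z shift) T ∧ T.IsNontrivial QCDField.glue ∧ T.IsNonGaussian QCDField.glue ∧
      (∀ f g : Fin Nf, f ≠ g → T.IsNontrivial (QCDField.pseudoRe f g)) ∧
      ∃ Δ > 0, T.HasMassGap Δ ∧ (reg.scheme m z shift).HasLatticeMassGap Δ) →
      ∀ J : ℝ, (∀ m : Fin Nf → ℝ, (∀ f, 0 < m f) → ∃ R : ℝ, 0 < R ∧
      PinClause Nf (QCDRegularisation.mk reg.a reg.a_pos reg.tendsto_a reg.β reg.L reg.tendsto_L
      (fun k => reg.mcrit k + reg.a k * J / reg.Zm k) reg.Zm reg.Zm_pos) 0 m R ∧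
      UpperPin Nf (QCDRegularisation.mk reg.a reg.a_pos reg.tendsto_a reg.β reg.L reg.tendsto_L
      (fun k => reg.mcrit k + reg.a k * J / reg.Zm k) reg.Zm reg.Zm_pos) 0 m R) →
      Tendsto reg.mcrit atTop (𝓝 0))
    (hLight : ∀ Nf : ℕ, (Nf = 2 ∨ Nf = 3) → ∀ reg : QCDRegularisation Nf, reg.HasMassScaling →
      (reg.scheme 0 0 0).HasAsymptoticScaling → (∀ᶠ k : ℕ in atTop, -1 ≤ reg.mcrit k) → ∀ M₀ : ℝ, 0 ≤ M₀ →
      (∀ m : Fin Nf → ℝ, (∀ f, M₀ < m f) → ∃ R : ℝ, 0 < R ∧ PinClause Nf reg M₀ m R ∧ UpperPin Nf reg M₀ m R) →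
      (∀ m : Fin Nf → ℝ, (∀ f, M₀ < m f) → ∃ (z shift : QCDField Nf → ℕ → ℝ) (T : OSData (QCDField Nf) 4),
      IsQCDAlong (reg.scheme m z shift) T ∧ T.IsNontrivial QCDField.glue ∧ T.IsNonGaussian QCDField.glue ∧
      (∀ f g : Fin Nf, f ≠ g → T.IsNontrivial (QCDField.pseudoRe f g)) ∧
      ∃ Δ > 0, T.HasMassGap Δ ∧ (reg.scheme m z shift).HasLatticeMassGap Δ) →
      ∀ J : ℝ, (∀ m : Fin Nf → ℝ, (∀ f, 0 < m f) → ∃ R : ℝ, 0 < R ∧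
      PinClause Nf (QCDRegularisation.mk reg.a reg.a_pos reg.tendsto_a reg.β reg.L reg.tendsto_L
      (fun k => reg.mcrit k + reg.a k * J / reg.Zm k) reg.Zm reg.Zm_pos) 0 m R ∧
      UpperPin Nf (QCDRegularisation.mk reg.a reg.a_pos reg.tendsto_a reg.β reg.L reg.tendsto_L
      (fun k => reg.mcrit k + reg.a k * J / reg.Zm k) reg.Zm reg.Zm_pos) 0 m R) →
      ∀ m : Fin Nf → ℝ, (∀ f, 0 < m f) → ∃ (z shift : QCDField Nf → ℕ → ℝ) (T : OSData (QCDField Nf) 4),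
      IsQCDAlong ((QCDRegularisation.mk reg.a reg.a_pos reg.tendsto_a reg.β reg.L reg.tendsto_L
      (fun k => reg.mcrit k + reg.a k * J / reg.Zm k) reg.Zm reg.Zm_pos).scheme
      m z shift) T ∧ T.IsNontrivial QCDField.glue ∧ T.IsNonGaussian QCDField.glue ∧
      (∀ f g : Fin Nf, f ≠ g → T.IsNontrivial (QCDField.pseudoRe f g)) ∧
      ∃ Δ > 0, T.HasMassGap Δ ∧
      ((QCDRegularisation.mk reg.a reg.a_pos reg.tendsto_a reg.β reg.L reg.tendsto_L
      (fun k => reg.mcrit k + reg.a k * J / reg.Zm k) reg.Zm reg.Zm_pos).scheme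
      m z shift).HasLatticeMassGap Δ)
    (hChiral : ∀ Nf : ℕ, (Nf = 2 ∨ Nf = 3) → ∀ reg' : QCDRegularisation Nf,
      reg'.HasMassScaling → (reg'.scheme 0 0 0).HasAsymptoticScaling → Tendsto reg'.mcrit atTop (𝓝 0) →
      (∀ m : Fin Nf → ℝ, (∀ f, 0 < m f) → ∃ R : ℝ, 0 < R ∧ PinClause Nf reg' 0 m R ∧ UpperPin Nf reg' 0 m R) →
      (∀ m : Fin Nf → ℝ, (∀ f, 0 < m f) → ∃ (z shift : QCDField Nf → ℕ → ℝ) (T : OSData (QCDField Nf) 4),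
      IsQCDAlong (reg'.scheme m z shift) T ∧ T.IsNontrivial QCDField.glue ∧ T.IsNonGaussian QCDField.glue ∧
      (∀ f g : Fin Nf, f ≠ g → T.IsNontrivial (QCDField.pseudoRe f g)) ∧
      ∃ Δ > 0, T.HasMassGap Δ ∧ (reg'.scheme m z shift).HasLatticeMassGap Δ) →
      reg'.IsChiralAtZero) :
    Summit.QuantumFields.QCD.Theses.NestedDissectionSea.LightQuarkCompletion := by
  intro Nf hNf reg hMS hAS hbr M₀ hM₀ hpin hbody
  have hNf16 : Nf ≤ 16 := by rcases hNf with rfl | rfl <;> norm_num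
  -- (B2a) the subsequence and the germ
  obtain ⟨φ, hφ, J, hpin'⟩ := hGerm Nf hNf reg hMS hAS hbr M₀ hM₀ hpin hbody
  -- the package passes to the subsequence
  set reg₁ : QCDRegularisation Nf := reg.restrict φ hφ.tendsto_atTop with hreg₁
  have hMS₁ : reg₁.HasMassScaling := StronglyChiralSubsequence.hasMassScaling_restrict reg φ hφ hMS
  have hAS₁ : (reg₁.scheme 0 0 0).HasAsymptoticScaling := StronglyChiralSubsequence.hasAsymptoticScaling_restrict reg φ hφ hAS
  have hbr₁ : ∀ᶠ k : ℕ in atTop, -1 ≤ reg₁.mcrit k := branch_restrict reg φ hφ hbr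
  have hpin₁ := pin_restrict reg φ hφ hpin
  have hbody₁ := body_restrict reg φ hφ hbody
  -- (B2b) the physical branch along the subsequence, (B2c) the light body of the re-centred regularisation
  have hlim₁ : Tendsto reg₁.mcrit atTop (𝓝 0) := hBranch Nf hNf reg₁ hMS₁ hAS₁ hbr₁ M₀ hM₀ hpin₁ hbody₁ J hpin'
  have hbody' := hLight Nf hNf reg₁ hMS₁ hAS₁ hbr₁ M₀ hM₀ hpin₁ hbody₁ J hpin'
  -- the witness: `reg₁` re-centred at `J`
  refine ⟨(QCDRegularisation.mk reg₁.a reg₁.a_pos reg₁.tendsto_a reg₁.β reg₁.L reg₁.tendsto_L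
      (fun k => reg₁.mcrit k + reg₁.a k * J / reg₁.Zm k) reg₁.Zm reg₁.Zm_pos : QCDRegularisation Nf),
    hasMassScaling_recentre reg₁ J hMS₁, hasAsymptoticScaling_recentre reg₁ J hAS₁,
    tendsto_mcrit_recentre reg₁ J hNf16 hMS₁ hlim₁, hpin', ?_, hbody'⟩
  -- (J) chirality of the re-centred regularisation
  exact hChiral Nf hNf _ (hasMassScaling_recentre reg₁ J hMS₁) (hasAsymptoticScaling_recentre reg₁ J hAS₁)
    (tendsto_mcrit_recentre reg₁ J hNf16 hMS₁ hlim₁) hpin' hbody'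

end Summit.QuantumFields.QCD.Theorems.LightQuarkJumpLine

end
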